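import Mathlib.FieldTheory.IsAlgClosed.Classification
import Mathlib.Analysis.Complex.Cardinality
import Mathlib.Analysis.Complex.Polynomial.Basic
import Mathlib.SetTheory.Cardinal.Subfield
import HarnessLib

/-!
# Fields of characteristic `0` and cardinality at most `𝔠` embed into `ℂ` (the Lefschetz principle)

Topic `FieldTheory/AlgClosed` (namespace `Literature.FieldTheory.AlgClosed`). Everything here is
PROVED; no definitions, no named facts.

* `nonempty_ringHom_of_lift_cardinalMk_le` — a field `K` of characteristic `0` embeds into every
  algebraically closed field `Ω` of characteristic `0` with `ℵ₀ < #Ω` and `#K ≤ #Ω` (universe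
  polymorphic, cardinal hypothesis in `Cardinal.lift` form). Proof (Steinitz): transcendence bases
  `s` of `K/ℤ` and `t` of `Ω/ℤ`; `#t = #Ω` because `Ω` is uncountable (Mathlib
  `IsAlgClosed.cardinal_eq_cardinal_transcendence_basis_of_aleph0_lt`), so `#s ≤ #K ≤ #Ω = #t` gives an
  injection `s ↪ t`, whence an embedding `ℤ[s] ≅ ℤ[X_s] ↪ ℤ[X_t] ≅ ℤ[t] ⊆ Ω`
  (`AlgebraicIndependent.aevalEquiv`, `MvPolynomial.rename_injective`); `K` is algebraic over `ℤ[s]`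
  (`IsTranscendenceBasis.isAlgebraic`) and `Ω` is algebraically closed, so the embedding extends to `K`
  (`IsAlgClosed.lift`).
* `nonempty_ringHom_complex_of_cardinalMk_le_continuum` — `#K ≤ 𝔠 ⟹ Nonempty (K →+* ℂ)`;
  `nonempty_ringHom_complex_of_countable` — every countable field of characteristic `0` embeds into `ℂ`;
  `Subfield.nonempty_ringHom_closure_complex` — the subfield generated by a countable subset of any field
  of characteristic `0` embeds into `ℂ` (the form in which the Lefschetz principle is USED: descend the
  finitely many coefficients of an algebraic datum to `K₀ = ℚ(coefficients)`, embed `K₀ ↪ ℂ`, base change).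

Mathlib (pin v4.32.0) has the classification of algebraically closed fields
(`IsAlgClosed.equivOfTranscendenceBasis`, `IsAlgClosed.ringEquiv_of_equiv_of_charZero`) and
`IsAlgClosed.lift` for ALGEBRAIC extensions, but no embedding statement for transcendental `K`
(`lean search` for `→+* ℂ` / `Nonempty (.* →+\* ` / `lift_of_cardinal`: only number-field embeddings,
and in the tree `PadicAlgClEquivComplex` (`ℚ̄_p ≃+* ℂ`), `AutomorphismExtension` (conjugacy of two GIVEN
embeddings of a countable field), `BrauerCharacter.exists_ringHom_wittVector_complex` (`W(k) ↪ ℂ` via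
Steinitz for ONE ring)). Deliberately NOT here: positive characteristic (same proof with `ZMod p`),
uniqueness up to `Aut(Ω)` (that is `AutomorphismExtension.exists_ringEquiv_apply_eq`).

## References

* E. Steinitz, *Algebraische Theorie der Körper*, J. reine angew. Math. 137 (1910), 167–309, §§22–24.
* S. Lang, *Algebra*, rev. 3rd ed., GTM 211, Springer 2002, Ch. VIII §1 (transcendence bases) and
  Ch. V §2 Thm. 2.8 (extension of embeddings to algebraic extensions). [Lang2002]
-/

noncomputable section

open Cardinal

universe u v

namespace Literature.FieldTheory.AlgClosed

/-- **Steinitz: small fields of characteristic `0` embed into big algebraically closed ones.** If `Ω`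
is an algebraically closed field of characteristic `0` with `ℵ₀ < #Ω`, and `K` is a field of
characteristic `0` with `#K ≤ #Ω` (stated with `Cardinal.lift`, `K` and `Ω` in arbitrary universes),
then there is a ring embedding `K →+* Ω`. [folklore] -/
theorem nonempty_ringHom_of_lift_cardinalMk_le {K : Type u} {Ω : Type v} [Field K] [CharZero K]
    [Field Ω] [IsAlgClosed Ω] [CharZero Ω] (hΩ : ℵ₀ < #Ω)
    (hK : Cardinal.lift.{v} #K ≤ Cardinal.lift.{u} #Ω) : Nonempty (K →+* Ω) := by
  -- transcendence bases over `ℤ`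
  obtain ⟨s, hs⟩ := exists_isTranscendenceBasis ℤ K
  obtain ⟨t, ht⟩ := exists_isTranscendenceBasis ℤ Ω
  -- `#t = #Ω ≥ #K ≥ #s`, so `s` injects into `t`
  have hct : #Ω = #t := lift_injective
    (IsAlgClosed.cardinal_eq_cardinal_transcendence_basis_of_aleph0_lt _ ht (le_of_eq mk_int) hΩ)
  have hst : Cardinal.lift.{v} #s ≤ Cardinal.lift.{u} #t := by
    rw [← hct]
    exact (lift_le.2 (mk_set_le s)).trans hK
  obtain ⟨e⟩ := Cardinal.lift_mk_le'.1 hst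
  -- the embedding `ℤ[s] ≅ ℤ[X_s] ↪ ℤ[X_t] ≅ ℤ[t] ⊆ Ω` of the purely transcendental part
  set A : Subalgebra ℤ K := Algebra.adjoin ℤ (Set.range ((↑) : s → K)) with hA
  set B : Subalgebra ℤ Ω := Algebra.adjoin ℤ (Set.range ((↑) : t → Ω)) with hB
  let f : A →ₐ[ℤ] Ω :=
    B.val.comp ((ht.1.aevalEquiv : MvPolynomial t ℤ →ₐ[ℤ] B).comp
      ((MvPolynomial.rename e).comp (hs.1.aevalEquiv.symm : A →ₐ[ℤ] MvPolynomial s ℤ)))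
  have hf : Function.Injective f := by
    simp only [f, AlgHom.coe_comp]
    exact Subtype.val_injective.comp (ht.1.aevalEquiv.injective.comp
      ((MvPolynomial.rename_injective _ e.injective).comp hs.1.aevalEquiv.symm.injective))
  -- `K / ℤ[s]` is algebraic and `Ω` is algebraically closed: extend `f` to `K`
  letI : Algebra A Ω := f.toRingHom.toAlgebra
  haveI : Module.IsTorsionFree A Ω := Module.isTorsionFree_iff_algebraMap_injective.mpr hf
  haveI : Algebra.IsAlgebraic A K := hs.isAlgebraic
  exact ⟨(IsAlgClosed.lift (R := A) (S := K) (M := Ω)).toRingHom⟩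

/-- **Every field of characteristic `0` and cardinality at most the continuum embeds into `ℂ`.**
[folklore] -/
theorem nonempty_ringHom_complex_of_cardinalMk_le_continuum (K : Type u) [Field K] [CharZero K]
    (hK : #K ≤ 𝔠) : Nonempty (K →+* ℂ) := by
  refine nonempty_ringHom_of_lift_cardinalMk_le (Ω := ℂ) ?_ ?_
  · rw [Cardinal.mk_complex]
    exact Cardinal.aleph0_lt_continuum
  · rw [Cardinal.mk_complex, lift_continuum, lift_uzero]
    exact hK

/-- **Every countable field of characteristic `0` embeds into `ℂ`.** [folklore] -/
theorem nonempty_ringHom_complex_of_countable (K : Type u) [Field K] [CharZero K] [Countable K] :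
    Nonempty (K →+* ℂ) :=
  nonempty_ringHom_complex_of_cardinalMk_le_continuum K (mk_le_aleph0.trans aleph0_le_continuum)

/-- **The Lefschetz principle, usable form**: in any field `K` of characteristic `0`, the subfield
generated by a countable set `S` embeds into `ℂ` (`#(closure S) ≤ max #S ℵ₀ ≤ 𝔠`). A dot-notation
extension of Mathlib's `Subfield` namespace, deliberately. [folklore] -/
theorem _root_.Subfield.nonempty_ringHom_closure_complex {K : Type u} [Field K] [CharZero K]
    {S : Set K} (hS : S.Countable) : Nonempty (Subfield.closure S →+* ℂ) := by
  refine nonempty_ringHom_complex_of_cardinalMk_le_continuum _ ?_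
  refine (Subfield.cardinalMk_closure_le_max S).trans ?_
  haveI : Countable S := hS.to_subtype
  exact max_le (mk_le_aleph0.trans aleph0_le_continuum) aleph0_le_continuum

end Literature.FieldTheory.AlgClosed

end
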